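import Mathlib
import Literature.Analysis.FluidPDE.Tao2016AveragedNS.SelfSimilarCascadeBlowup
import Literature.Analysis.FluidPDE.Tao2016AveragedNS.LocalCascadeSolutions
import Literature.Analysis.FluidPDE.Tao2016AveragedNS.WeightedLatticeFlows
import Literature.Analysis.FluidPDE.Tao2016AveragedNS.ViscousLatticeFlows
import Literature.Analysis.FluidPDE.Tao2016AveragedNS.ViscousLatticeUniqueness
import Literature.Analysis.FluidPDE.Tao2016AveragedNS.ViscousEnvelopeSmoothing
import Summits.NavierStokesRegularity.NavierStokesRegularity.Theses.TaoLadderRungTwoBreak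
import Summits.NavierStokesRegularity.NavierStokesRegularity.Theorems.WakeRatchetMinimalViscousBlowupMaximalBlowup
import HarnessLib

/-!
# Robust blow-up (`NoGlobalCascade`) forces FINITE-TIME LOSS OF (4.5)-REGULARITY of the exact and of
  every slightly viscous cascade lattice flow from the one-shell datum — the physical-time first rung
  of the ω-limit line of K2(1) `TaoLadderRungTwoBreak.BlowupRigidityOne`
  (stmt-NavierStokesRegularity-20206, registered stub `stub_eternalFromBlowup` = `∀ R ≥ 1,
  EternalRigidityFwd R 1`) and of K2ᵛ(1) `EternalRigidityViscBddOne` (stmt-…-20420, `stub_viscousBlowup`)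

MODEL lattice ODEs only (Tao 2016 §4: the cascade lattice (4.8)/(4.12) and its NS-scaled viscous form
displayed before Theorem 4.2, for a table of the comparable class `E₂(R)`); nothing in this file is a
statement about the Navier–Stokes equations, and NO item is closed (`--supports
stmt-NavierStokesRegularity-20206`).

THE POINT. The extraction stub of K2(1) asks for an ω-limit, in self-similar variables, of «the
blow-up» of a robustly blowing-up table. Its hypothesis `NoGlobalCascade ε₀ α X₀` is a statement about
NON-EXISTENCE OF GLOBAL PSEUDO-SOLUTIONS with defects, for all large starting shells; before any
renormalisation one needs an honest blow-up TIME of an honest trajectory. This file supplies it, in the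
tree's vocabulary and with the tree's well-posedness theory of the lattice:

* `apriori_bound_fails_of_noGlobalCascade` — NORM INFLATION. By the κ-normal form
  (`noGlobalCascade_iff_kappa`: robust blow-up ⇔ `∃ κ > 0`, no global `(κ,κ)`-pseudo-solution from shell
  `0`), the fact that a global regular `ν`-viscous solution is a `(ν√2, 0)`-pseudo-solution
  (`hasGlobal_of_viscousGlobal`, `hasGlobal_mono`) and the CONTINUATION CRITERION of the viscous lattice
  (`exists_viscousGlobal_of_apriori_bound`, Duhamel–Picard), for every viscosity `0 ≤ ν ≤ κ/√2`
  (including the INVISCID lattice `ν = 0`) and every admissible weight `w` dominating the (4.5) weight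
  there is a finite horizon `T` before which regular solutions from the datum reach ARBITRARILY LARGE
  weighted amplitude `sup w_k |X_{i,k}|`.
* `noBoundedFlow_of_noGlobalCascade` — with UNIQUENESS of regular flows (`viscousFlow_unique`) this
  becomes: NO solution of the `ν`-viscous lattice from the datum with a finite weighted bound exists on
  `[0,T]` (a bounded one would, by uniqueness, bound all the inflating ones).
* `noRegularFlow_of_noGlobalCascade` — the same with Tao's a priori weight (4.5)
  `sup_{t ≤ T} sup_{i,k} (1+(1+ε₀)^{10k})|X_{i,k}(t)| < ∞` (weight `(1+ε₀)^{10k⁺}`,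
  `weightRatiosLE_aprioriWeight`, `aprioriWeight_le_weight45` of the WakeRatchet kit);
  `noRegularExactFlow_of_noGlobalCascade` — its inviscid case `ν = 0`;
* `not_viscousGlobal_of_noGlobalCascade` / `maximalBlowup_of_noGlobalCascade` — the JOIN with route
  WakeRatchet's maximal-solution object (`MinimalViscousBlowup.ThresholdRay.maximalBlowup`, stub S3a of
  crux ⟨22743⟩, `ν > 0`): robust blow-up forbids a global regular `ν`-viscous solution for every
  `0 ≤ ν ≤ κ/√2`, hence for `0 < ν ≤ κ/√2` the `ν`-viscous lattice from the datum has a MAXIMAL regular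
  solution on some `[0,T⋆)` whose (4.5) norm is unbounded — the trajectory the K2ᵛ(1) extraction
  (⟨22744⟩ `MinimalBlowupExtraction`, proved) renormalises, now available FROM THE HYPOTHESIS OF K2(1)/K2ᵛ(1);
* `noLocalExactPseudoSolution_of_noGlobalCascade` — in Tao's own format: robust blow-up from the
  one-shell datum `X₀` implies that for some `T > 0` there is NO LOCAL EXACT pseudo-solution
  `CascadeODESolutionOn T ε₀ α 0 K₂ 0 X₀ X E` (Lemma 4.1's conclusions on `[0,T]` with motion defect
  `K₁ = 0`, any energy defect `K₂`). Since exact local flows exist on short windows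
  (`exists_exact_pseudoFlowOn_short_of_inTableClass`), this is finite-time blow-up of the (4.5) norm
  along the exact trajectory — the object whose renormalisation `W_n(σ) = Λ^n e^{-σ} X_n(t⋆ - e^{-σ})`
  the ω-limit stubs start from.

RELATION TO THE TREE. `MinimalViscousBlowup.ThresholdRay.maximalBlowup` (WakeRatchet) builds the
maximal solution for `ν > 0` from `¬ ∃ X, ViscousGlobal ε₀ ν α X₀ X`; this file starts one step
earlier (from `NoGlobalCascade`, the hypothesis of the K2 cruxes), covers the INVISCID lattice `ν = 0`
and the whole interval `0 ≤ ν ≤ κ/√2` with one horizon statement, and phrases the exact case in Tao's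
`CascadeODESolutionOn` format; general `m`.

What is NOT here: the blow-up RATE (type I in self-similar variables — the open step N-39 of the
cell), compactness modulo shell shift, and the passage of (S₁)-survival to the limit.
-/

noncomputable section

-- the summit and its single sub-problem share the name (CONVENTIONS §1)
set_option linter.dupNamespace false

namespace Summit.NavierStokesRegularity.NavierStokesRegularity.Theorems

namespace BlowupRigidityOne

open Set
open Literature.Analysis.FluidPDE Literature.Analysis.FluidPDE.TaoCascade

variable {m : ℕ}

/-! ### Norm inflation before a finite horizon -/

/-- **NORM INFLATION FROM ROBUST BLOW-UP.** Let `ε₀ > 0`, `α ∈ E₂(R)` (`InTableClass R α`), `w` an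
admissible weight (`WeightRatiosLE ε₀ w A`) dominating the (4.5) weight (`(1+(1+ε₀)^{10k})/w_k ≤ D`),
and let the one-shell datum `X₀` at shell `0` blow up robustly (`NoGlobalCascade ε₀ α X₀`). Then there
is `κ > 0` such that for every viscosity `0 ≤ ν ≤ κ/√2` there is a horizon `T > 0` with: for every
level `B`, some regular solution of the `ν`-viscous lattice `∂ₜX_{i,k} = quadTerm_{i,k}(X) −
ν(1+ε₀)^{2k}X_{i,k}` from `X₀` on a window `[0,s] ⊆ [0,T]` (no shells below `0`, continuous
components, finite weighted bound) exceeds `B` in weighted amplitude somewhere on `[0,s]`. (Otherwise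
the continuation criterion would produce a global regular viscous solution, i.e. a global
`(ν√2,0)`-pseudo-solution, against the κ-normal form of robust blow-up.)
[cite: Tao2016AveragedNS, §4 Thm. 4.2 with Lemma 4.1 (4.5)–(4.11) and the viscous equation before Thm. 4.2; Teschl2012, Cor. 2.16] -/
theorem apriori_bound_fails_of_noGlobalCascade {ε₀ A D R : ℝ}
    {α : Fin m → Fin m → Fin m → ℤ × ℤ × ℤ → ℝ} {w : ℤ → ℝ} {X₀ : Fin m → ℝ}
    (hε : 0 < ε₀) (hw : WeightRatiosLE ε₀ w A) (hα : InTableClass R α)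
    (hD : ∀ k : ℤ, (1 + (1 + ε₀) ^ ((10 : ℝ) * k)) / w k ≤ D)
    (hNG : NoGlobalCascade ε₀ α X₀) :
    ∃ κ : ℝ, 0 < κ ∧ ∀ ν : ℝ, 0 ≤ ν → ν * Real.sqrt 2 ≤ κ →
      ∃ T : ℝ, 0 < T ∧ ∀ B : ℝ, ∃ s ∈ Ioc 0 T, ∃ X : Fin m → ℤ → ℝ → ℝ,
        (∀ i k, X i k 0 = if k = 0 then X₀ i else 0) ∧
        (∀ i k, k < 0 → ∀ t, X i k t = 0) ∧
        (∃ M : ℝ, ∀ t i k, w k * |X i k t| ≤ M) ∧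
        (∀ i k, Continuous (X i k)) ∧
        (∀ i k, ∀ t ∈ Icc 0 s, HasDerivWithinAt (X i k)
          (quadTerm ε₀ α X i k t - ν * (1 + ε₀) ^ ((2 : ℝ) * k) * X i k t) (Icc 0 s) t) ∧
        ∃ t ∈ Icc 0 s, ∃ i k, B < w k * |X i k t| := by
  obtain ⟨κ, hκ, hno⟩ := (noGlobalCascade_iff_kappa hε).1 hNG
  refine ⟨κ, hκ, fun ν hν hνκ => ?_⟩
  have hε' : 0 ≤ 1 + ε₀ := by linarith
  -- the a priori hypothesis of the continuation criterion (for the table restricted to `S`) must FAIL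
  have key : ¬ ∀ T : ℝ, 0 < T → ∃ B : ℝ, ∀ s ∈ Ioc 0 T, ∀ X : Fin m → ℤ → ℝ → ℝ,
      (∀ i k, X i k 0 = if k = 0 then X₀ i else 0) →
      (∀ i k, k < 0 → ∀ t, X i k t = 0) →
      (∃ M : ℝ, ∀ t i k, w k * |X i k t| ≤ M) →
      (∀ i k, Continuous (X i k)) →
      (∀ i k, ∀ t ∈ Icc 0 s, HasDerivWithinAt (X i k)
        (quadTerm ε₀ α X i k t - ν * (1 + ε₀) ^ ((2 : ℝ) * k) * X i k t) (Icc 0 s) t) →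
      ∀ t ∈ Icc 0 s, ∀ i k, w k * |X i k t| ≤ B := by
    intro hap
    apply hno
    obtain ⟨X, hX⟩ := exists_viscousGlobal_of_apriori_bound (α := restrictShiftSet α) hε' hw
      zero_le_one (abs_restrictShiftSet_le zero_le_one (abs_le_one_of_inTableClass hα)) hD hν X₀
      (fun T hT => by
        obtain ⟨B, hB⟩ := hap T hT
        refine ⟨B, fun s hs X h1 h2 h3 h4 h5 => hB s hs X h1 h2 h3 h4 fun i k t ht => ?_⟩
        simpa only [quadTerm_restrictShiftSet] using h5 i k t ht)
    exact hasGlobal_mono hε.le (hasGlobal_of_viscousGlobal hε hν hX.of_restrictShiftSet) hνκ hκ.le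
  push Not at key
  obtain ⟨T, hT, hTB⟩ := key
  refine ⟨T, hT, fun B => ?_⟩
  obtain ⟨s, hs, X, h1, h2, h3, h4, h5, t, ht, i, k, hlt⟩ := hTB B
  exact ⟨s, hs, X, h1, h2, h3, h4, h5, t, ht, i, k, hlt⟩

/-! ### No bounded flow reaches the horizon -/

/-- **NO WEIGHTED-BOUNDED FLOW ON `[0,T]`.** Same setting. For every viscosity `0 ≤ ν ≤ κ/√2` there is
`T > 0` such that NO family `X` with the one-shell datum at time `0`, the `ν`-viscous lattice law on
`[0,T]` (one-sided derivatives within `[0,T]`) and a finite weighted bound `sup_{[0,T]} w_k|X_{i,k}| < ∞`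
exists: by uniqueness of regular flows (`viscousFlow_unique`) such an `X` would coincide on every
sub-window with the inflating solutions of `apriori_bound_fails_of_noGlobalCascade` and bound them.
[cite: Tao2016AveragedNS, §4 Thm. 4.2 with Lemma 4.1 (4.5), (4.8), (4.12) and the viscous equation before Thm. 4.2; Teschl2012, Thm. 2.2, Cor. 2.16] -/
theorem noBoundedFlow_of_noGlobalCascade {ε₀ A D R : ℝ}
    {α : Fin m → Fin m → Fin m → ℤ × ℤ × ℤ → ℝ} {w : ℤ → ℝ} {X₀ : Fin m → ℝ}
    (hε : 0 < ε₀) (hw : WeightRatiosLE ε₀ w A) (hα : InTableClass R α)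
    (hD : ∀ k : ℤ, (1 + (1 + ε₀) ^ ((10 : ℝ) * k)) / w k ≤ D)
    (hNG : NoGlobalCascade ε₀ α X₀) :
    ∃ κ : ℝ, 0 < κ ∧ ∀ ν : ℝ, 0 ≤ ν → ν * Real.sqrt 2 ≤ κ →
      ∃ T : ℝ, 0 < T ∧ ¬ ∃ X : Fin m → ℤ → ℝ → ℝ,
        (∀ i k, X i k 0 = if k = 0 then X₀ i else 0) ∧
        (∀ i k, ∀ t ∈ Icc 0 T, HasDerivWithinAt (X i k)
          (quadTerm ε₀ α X i k t - ν * (1 + ε₀) ^ ((2 : ℝ) * k) * X i k t) (Icc 0 T) t) ∧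
        ∃ M : ℝ, ∀ t ∈ Icc 0 T, ∀ i k, w k * |X i k t| ≤ M := by
  obtain ⟨κ, hκ, H⟩ := apriori_bound_fails_of_noGlobalCascade hε hw hα hD hNG
  refine ⟨κ, hκ, fun ν hν hνκ => ?_⟩
  obtain ⟨T, hT, HB⟩ := H ν hν hνκ
  refine ⟨T, hT, ?_⟩
  rintro ⟨X, hX0, hXd, M, hXM⟩
  -- an inflating regular solution `Y` on `[0,s] ⊆ [0,T]` exceeding the level `M`
  obtain ⟨s, hs, Y, hY0, -, ⟨MY, hYM⟩, -, hYd, t, ht, i, k, hlt⟩ := HB M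
  have hε' : 0 ≤ 1 + ε₀ := by linarith
  have hsT : Icc (0 : ℝ) s ⊆ Icc 0 T := Icc_subset_Icc le_rfl hs.2
  -- uniqueness on `[0,s]` in the ball `max M MY` (for the table restricted to `S`, `|α| ≤ 1`)
  have huniq := viscousFlow_unique (α := restrictShiftSet α) (B := max M MY) (s := s) hε' hw
    zero_le_one (abs_restrictShiftSet_le zero_le_one (abs_le_one_of_inTableClass hα)) hν
    (X := X) (Y := Y) (fun i k => by rw [hX0, hY0])
    (fun τ hτ i k => (hXM τ (hsT hτ) i k).trans (le_max_left _ _))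
    (fun τ _ i k => (hYM τ i k).trans (le_max_right _ _))
    (fun i k τ hτ => by
      simpa only [quadTerm_restrictShiftSet] using (hXd i k τ (hsT hτ)).mono hsT)
    (fun i k τ hτ => by simpa only [quadTerm_restrictShiftSet] using hYd i k τ hτ)
  have hXY : X i k t = Y i k t := huniq t ht i k
  have hle : w k * |Y i k t| ≤ M := by rw [← hXY]; exact hXM t (hsT ht) i k
  exact absurd hle (not_le.2 hlt)

/-! ### With Tao's a priori weight (4.5) -/

/-- **ROBUST BLOW-UP ⇒ NO (4.5)-REGULAR FLOW ON `[0,T]`** (the headline, with Tao's a priori weight).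
Let `ε₀ > 0`, `α ∈ E₂(R)` and `NoGlobalCascade ε₀ α X₀`. There is `κ > 0` such that for every viscosity
`0 ≤ ν ≤ κ/√2` — including the inviscid lattice — there is `T > 0` such that NO family
`X : Fin m → ℤ → ℝ → ℝ` has the one-shell datum `X_{i,k}(0) = X₀ᵢ 1_{k=0}`, solves the `ν`-viscous
lattice `∂ₜX_{i,k} = quadTerm_{i,k}(X) − ν(1+ε₀)^{2k}X_{i,k}` on `[0,T]`, and obeys the a priori bound
(4.5) `sup_{0≤t≤T} sup_{i,k} (1+(1+ε₀)^{10k})|X_{i,k}(t)| < ∞`.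
[cite: Tao2016AveragedNS, §4 Thm. 4.2 with Lemma 4.1 (4.5), (4.8), (4.12) and the viscous equation before Thm. 4.2; Teschl2012, Thm. 2.2, Cor. 2.16] -/
theorem noRegularFlow_of_noGlobalCascade {ε₀ R : ℝ}
    {α : Fin m → Fin m → Fin m → ℤ × ℤ × ℤ → ℝ} {X₀ : Fin m → ℝ}
    (hε : 0 < ε₀) (hα : InTableClass R α) (hNG : NoGlobalCascade ε₀ α X₀) :
    ∃ κ : ℝ, 0 < κ ∧ ∀ ν : ℝ, 0 ≤ ν → ν * Real.sqrt 2 ≤ κ →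
      ∃ T : ℝ, 0 < T ∧ ¬ ∃ X : Fin m → ℤ → ℝ → ℝ,
        (∀ i k, X i k 0 = if k = 0 then X₀ i else 0) ∧
        (∀ i k, ∀ t ∈ Icc 0 T, HasDerivWithinAt (X i k)
          (quadTerm ε₀ α X i k t - ν * (1 + ε₀) ^ ((2 : ℝ) * k) * X i k t) (Icc 0 T) t) ∧
        ∃ M : ℝ, ∀ t ∈ Icc 0 T, ∀ (i : Fin m) (k : ℤ),
          (1 + (1 + ε₀) ^ ((10 : ℝ) * k)) * |X i k t| ≤ M := by
  obtain ⟨κ, hκ, H⟩ := noBoundedFlow_of_noGlobalCascade hε (weightRatiosLE_aprioriWeight hε.le) hα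
    (fun k => aprioriWeight_dominates hε.le k) hNG
  refine ⟨κ, hκ, fun ν hν hνκ => ?_⟩
  obtain ⟨T, hT, hno⟩ := H ν hν hνκ
  refine ⟨T, hT, ?_⟩
  rintro ⟨X, hX0, hXd, M, hXM⟩
  refine hno ⟨X, hX0, hXd, M, fun t ht i k => ?_⟩
  exact (mul_le_mul_of_nonneg_right
    (MinimalViscousBlowup.ThresholdRay.aprioriWeight_le_weight45 hε.le k) (abs_nonneg _)).trans
      (hXM t ht i k)

/-- **The inviscid case `ν = 0`: robust blow-up ⇒ the EXACT cascade lattice flow from the one-shell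
datum is not (4.5)-regular up to some finite time `T`** — no family with the datum at time `0`, the
exact law `∂ₜX_{i,k} = quadTerm_{i,k}(X)` on `[0,T]` and the a priori bound (4.5) on `[0,T]`.
[cite: Tao2016AveragedNS, §4 Thm. 4.2 with Lemma 4.1 (4.5), (4.8), (4.12); Teschl2012, Thm. 2.2, Cor. 2.16] -/
theorem noRegularExactFlow_of_noGlobalCascade {ε₀ R : ℝ}
    {α : Fin m → Fin m → Fin m → ℤ × ℤ × ℤ → ℝ} {X₀ : Fin m → ℝ}
    (hε : 0 < ε₀) (hα : InTableClass R α) (hNG : NoGlobalCascade ε₀ α X₀) :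
    ∃ T : ℝ, 0 < T ∧ ¬ ∃ X : Fin m → ℤ → ℝ → ℝ,
      (∀ i k, X i k 0 = if k = 0 then X₀ i else 0) ∧
      (∀ i k, ∀ t ∈ Icc 0 T, HasDerivWithinAt (X i k) (quadTerm ε₀ α X i k t) (Icc 0 T) t) ∧
      ∃ M : ℝ, ∀ t ∈ Icc 0 T, ∀ (i : Fin m) (k : ℤ),
        (1 + (1 + ε₀) ^ ((10 : ℝ) * k)) * |X i k t| ≤ M := by
  obtain ⟨κ, hκ, H⟩ := noRegularFlow_of_noGlobalCascade hε hα hNG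
  obtain ⟨T, hT, hno⟩ := H 0 le_rfl (by rw [zero_mul]; exact hκ.le)
  refine ⟨T, hT, ?_⟩
  rintro ⟨X, hX0, hXd, hXM⟩
  refine hno ⟨X, hX0, fun i k t ht => ?_, hXM⟩
  simpa only [zero_mul, sub_zero] using hXd i k t ht

/-- **In Tao's format: robust blow-up ⇒ no LOCAL EXACT pseudo-solution on `[0,T]` for some `T > 0`.**
If `NoGlobalCascade ε₀ α X₀` (`ε₀ > 0`, `α ∈ E₂(R)`), then for some `T > 0` the conclusions
(4.5)–(4.11) of Lemma 4.1 on `[0,T]` with motion defect `K₁ = 0` (any energy defect `K₂`) have NO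
solution from the one-shell datum `X₀` at shell `0`: `¬ CascadeODESolutionOn T ε₀ α 0 K₂ 0 X₀ X E`.
Exact local flows do exist on short windows (`exists_exact_pseudoFlowOn_short_of_inTableClass`), so
this is finite-time blow-up of the a priori norm (4.5) along the exact trajectory.
[cite: Tao2016AveragedNS, §4 Thm. 4.2 with Lemma 4.1 (4.5)–(4.11), (4.12); Teschl2012, Thm. 2.2, Cor. 2.16] -/
theorem noLocalExactPseudoSolution_of_noGlobalCascade {ε₀ R : ℝ}
    {α : Fin m → Fin m → Fin m → ℤ × ℤ × ℤ → ℝ} {X₀ : Fin m → ℝ}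
    (hε : 0 < ε₀) (hα : InTableClass R α) (hNG : NoGlobalCascade ε₀ α X₀) :
    ∃ T : ℝ, 0 < T ∧ ∀ (K₂ : ℝ) (X E : Fin m → ℤ → ℝ → ℝ),
      ¬ CascadeODESolutionOn T ε₀ α 0 K₂ 0 X₀ X E := by
  obtain ⟨T, hT, hno⟩ := noRegularExactFlow_of_noGlobalCascade hε hα hNG
  refine ⟨T, hT, fun K₂ X E hsol => hno ⟨X, hsol.init_X, fun i k t ht => ?_, hsol.apriori_X⟩⟩
  -- `K₁ = 0`: the motion law is exact, and `C¹` on `[0,T]` gives the one-sided derivative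
  have hd : DifferentiableWithinAt ℝ (X i k) (Icc 0 T) t :=
    ((hsol.contDiffOn_X i k).differentiableOn one_ne_zero) t ht
  have hm := hsol.motion i k t ht
  rw [zero_mul, zero_mul, abs_nonpos_iff, sub_eq_zero] at hm
  rw [← hm]
  exact hd.hasDerivWithinAt

/-! ### Join with the WakeRatchet maximal-solution object (`ν > 0`) -/

/-- **Robust blow-up forbids global regular viscous solutions at small viscosity**: if
`NoGlobalCascade ε₀ α X₀` (`ε₀ > 0`) then there is `κ > 0` such that for every `0 ≤ ν ≤ κ/√2` the
NS-scaled `ν`-viscous lattice has NO global regular solution from the one-shell datum `X₀`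
(`¬ ViscousGlobal ε₀ ν α X₀ X` for all `X`) — a global regular `ν`-viscous solution is a global
`(ν√2, 0)`-pseudo-solution (`hasGlobal_of_viscousGlobal`), excluded by the κ-normal form
(`noGlobalCascade_iff_kappa`, `hasGlobal_mono`). Any table, any `m`.
[cite: Tao2016AveragedNS, §4 Thm. 4.2 with Lemma 4.1 (4.5)–(4.11) and the remark after (4.11)] -/
theorem not_viscousGlobal_of_noGlobalCascade {ε₀ : ℝ}
    {α : Fin m → Fin m → Fin m → ℤ × ℤ × ℤ → ℝ} {X₀ : Fin m → ℝ}
    (hε : 0 < ε₀) (hNG : NoGlobalCascade ε₀ α X₀) :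
    ∃ κ : ℝ, 0 < κ ∧ ∀ ν : ℝ, 0 ≤ ν → ν * Real.sqrt 2 ≤ κ →
      ¬ ∃ X : Fin m → ℤ → ℝ → ℝ, ViscousGlobal ε₀ ν α X₀ X := by
  obtain ⟨κ, hκ, hno⟩ := (noGlobalCascade_iff_kappa hε).1 hNG
  refine ⟨κ, hκ, fun ν hν hνκ => ?_⟩
  rintro ⟨X, hX⟩
  exact hno (hasGlobal_mono hε.le (hasGlobal_of_viscousGlobal hε hν hX) hνκ hκ.le)

/-- **Robust blow-up ⇒ a MAXIMAL regular `ν`-viscous solution blowing up in the (4.5) norm, for every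
small positive viscosity** (`m = 4`, `α ∈ E₂(R)`): the conclusion of route WakeRatchet's
`MinimalViscousBlowup.ThresholdRay.maximalBlowup` (stub S3a of crux ⟨22743⟩: `C¹` on `[0,T⋆)`, datum, no
shells below `0`, the viscous motion on `[0,T⋆)`, (4.5)-regular on every `[0,T']`, `T' < T⋆`, (4.5)
norm unbounded on `[0,T⋆)`), now obtained from the hypothesis `NoGlobalCascade ε₀ α X₀` of K2(1)/K2ᵛ(1)
for every `0 < ν ≤ κ/√2` via `not_viscousGlobal_of_noGlobalCascade`.
[cite: Tao2016AveragedNS, §4 Thm. 4.2 and the viscous lattice before Thm. 4.2; Teschl2012, §2.6 Cor. 2.16 (maximal solutions)] -/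
theorem maximalBlowup_of_noGlobalCascade {ε₀ R : ℝ}
    {α : Fin 4 → Fin 4 → Fin 4 → ℤ × ℤ × ℤ → ℝ} {X₀ : Fin 4 → ℝ}
    (hε : 0 < ε₀) (hR : 1 ≤ R) (hα : InTableClass R α) (hNG : NoGlobalCascade ε₀ α X₀) :
    ∃ κ : ℝ, 0 < κ ∧ ∀ ν : ℝ, 0 < ν → ν * Real.sqrt 2 ≤ κ →
      ∃ (T : ℝ) (X : Fin 4 → ℤ → ℝ → ℝ), 0 < T ∧
        (∀ i n, ContDiffOn ℝ 1 (X i n) (Set.Ico 0 T)) ∧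
        (∀ i n, X i n 0 = if n = 0 then X₀ i else 0) ∧
        (∀ i n t, n < 0 → X i n t = 0) ∧
        (∀ i n t, 0 ≤ t → t < T → derivWithin (X i n) (Set.Ici 0) t =
          quadTerm ε₀ α X i n t - ν * (1 + ε₀) ^ ((2 : ℝ) * n) * X i n t) ∧
        (∀ T' : ℝ, 0 < T' → T' < T → ∃ M : ℝ, ∀ t : ℝ, 0 ≤ t → t ≤ T' →
          ∀ (i : Fin 4) (n : ℤ), (1 + (1 + ε₀) ^ ((10 : ℝ) * n)) * |X i n t| ≤ M) ∧
        (∀ M : ℝ, ∃ t : ℝ, 0 ≤ t ∧ t < T ∧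
          ∃ (i : Fin 4) (n : ℤ), M < (1 + (1 + ε₀) ^ ((10 : ℝ) * n)) * |X i n t|) := by
  obtain ⟨κ, hκ, H⟩ := not_viscousGlobal_of_noGlobalCascade hε hNG
  exact ⟨κ, hκ, fun ν hν hνκ =>
    MinimalViscousBlowup.ThresholdRay.maximalBlowup ε₀ hε R hR α X₀ hα ν hν (H ν hν.le hνκ)⟩

end BlowupRigidityOne

end Summit.NavierStokesRegularity.NavierStokesRegularity.Theorems

end
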